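import Mathlib
import HarnessLib
import Summits.Ventures.LatticeQCDFlow.Exactness.BoxMuller
import Summits.Ventures.LatticeQCDFlow.Exactness.RejectionSampling
import Summits.Ventures.LatticeQCDFlow.Exactness.KennedyPendletonSampler

/-!
# The Marsaglia polar Gaussian generator is exact: rejection to the disc, then two independent `N(0,1)`

HONEST FRAMING: exact (Metropolis-corrected) sampling algorithms for lattice gauge theory;
figures of merit are autocorrelation/cost numbers at stated couplings and volumes; no
continuum-physics claim.

Venture `LatticeQCDFlow` (cell pub-lqcd), topic `Exactness`, FANOUT row 9 (eng-latcore, the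
engine `latflow.core`).  NEW WORK of the cell over Mathlib (`lintegral_comp_polarCoord_symm`,
`gaussianReal`) and row 9's `RejectionSampling.lean` (the loop outputs the normalised accepted
part), `BoxMuller.lean` (the Rayleigh radius `√(−2 log s)`), `CircleUniformAngle.lean`
(`lintegral_gaussian2_polar`).  Nothing is cited as a fact.  Printed counterpart, NAMED ONLY:
Marsaglia–Bray, SIAM Rev. 6 (1964) 260.

The Gaussian primitive of the 2-d kernels (`csrc/cpn_kernel.c` and `csrc/phi4_kernel.c` `rng_gauss`:
CP(N−1) perpendicular draws, Marsaglia–Tsang's `x`, site Metropolis proposals, φ⁴/CP(N−1) HMC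
momenta) is the polar method: `do { u = 2U₁−1; v = 2U₂−1; s = u²+v² } while (s ≥ 1 ∨ s = 0)`,
`f = √(−2 log s / s)`, return `u·f` and cache `v·f` as the next variate.  In idealised real
arithmetic:

* `polarPt`, `polarDisc`, `polarRound` — one round; **`map_polarPt_unitLaw`** — `(2U₁−1, 2U₂−1)` is
  `¼ ×` Lebesgue on the square `(−1,1)²`; **`loopLaw_polarRound`** — THE REJECTION LOOP OUTPUTS THE
  UNIFORM LAW ON THE PUNCTURED UNIT DISC `(vol D)⁻¹ • vol|_D`;
* `polarOut` — the output pair `(u f, v f)`; **`setLIntegral_polarDisc_polarOut`** — for measurable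
  `H ≥ 0`, `∫_D H(polarOut p) dp = π ∫ H d(N(0,1) ⊗ N(0,1))` (polar coordinates, `s = r²`, the
  Rayleigh substitution of `BoxMuller.lean`); `volume_polarDisc` — hence `vol D = π`;
* **`map_polarOut_loopLaw_polarRound`** — THE POLAR METHOD IS EXACT: the output pair of the loop is
  EXACTLY `N(0,1) ⊗ N(0,1)` — the returned variate and the cached `spare` are independent standard
  Gaussians (`map_polarOut_fst`: each is `gaussianReal 0 1`).

NOT CLAIMED: floating point; the `has_spare` bookkeeping across calls (pure state threading).
-/

namespace Summit.Ventures.LatticeQCDFlow.Exactness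

open MeasureTheory Measure Set Real ProbabilityTheory
open scoped ENNReal

/-! ## §1 One round: two uniforms, an affine map, the disc test -/

/-- `s = u² + v²`. -/
def sq2 (p : ℝ × ℝ) : ℝ := p.1 ^ 2 + p.2 ^ 2

/-- `sq2` is measurable. -/
theorem measurable_sq2 : Measurable sq2 := by unfold sq2; fun_prop

/-- The ACCEPT EVENT: the punctured open unit disc `0 < s < 1`. -/
abbrev polarDisc : Set (ℝ × ℝ) := {p | 0 < sq2 p ∧ sq2 p < 1}

/-- The accept event is measurable. -/
theorem measurableSet_polarDisc : MeasurableSet polarDisc :=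
  (measurableSet_lt measurable_const measurable_sq2).inter (measurableSet_lt measurable_sq2 measurable_const)

/-- The disc lies in the square `(−1,1)²`. -/
theorem polarDisc_subset_square : polarDisc ⊆ Ioo (-1 : ℝ) 1 ×ˢ Ioo (-1 : ℝ) 1 := by
  rintro ⟨u, v⟩ ⟨-, h1⟩
  simp only [sq2] at h1
  refine ⟨⟨?_, ?_⟩, ⟨?_, ?_⟩⟩ <;> nlinarith [sq_nonneg u, sq_nonneg v, sq_nonneg (u + 1), sq_nonneg (u - 1),
    sq_nonneg (v + 1), sq_nonneg (v - 1)]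

/-- `(U₁, U₂) ↦ (2U₁ − 1, 2U₂ − 1)`. -/
noncomputable def polarPt (q : ℝ × ℝ) : ℝ × ℝ := (2 * q.1 - 1, 2 * q.2 - 1)

/-- `polarPt` is measurable. -/
theorem measurable_polarPt : Measurable polarPt := by unfold polarPt; fun_prop

/-- **One round of the polar method**: the point `(2U₁−1, 2U₂−1)`, accepted iff it lies in the
punctured open unit disc. -/
noncomputable def polarRound : Measure ((ℝ × ℝ) × Bool) :=
  (unitLaw.prod unitLaw).map fun q => (polarPt q, decide (polarPt q ∈ polarDisc))

/-- The round map is measurable. -/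
theorem measurable_polarRoundMap : Measurable fun q : ℝ × ℝ => (polarPt q, decide (polarPt q ∈ polarDisc)) :=
  measurable_polarPt.prodMk (measurable_decide (measurable_polarPt measurableSet_polarDisc))

/-- One round is a probability law. -/
instance isProbabilityMeasure_polarRound : IsProbabilityMeasure polarRound :=
  isProbabilityMeasure_map measurable_polarRoundMap.aemeasurable

/-! ## §2 The affine image of the unit square -/

/-- `u ↦ 2u − 1` maps `(0,1)` onto `(−1,1)`; for every `G ≥ 0`,
`∫ G(2u−1) d unitLaw(u) = ½ ∫_{(−1,1)} G(t) dt`. -/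
theorem lintegral_two_mul_sub_one_unitLaw (G : ℝ → ℝ≥0∞) :
    ∫⁻ u, G (2 * u - 1) ∂unitLaw = ENNReal.ofReal (1 / 2) * ∫⁻ t in Ioo (-1) 1, G t := by
  have himg : (fun u : ℝ => 2 * u - 1) '' Ioo 0 1 = Ioo (-1) 1 := by
    ext t
    constructor
    · rintro ⟨u, hu, rfl⟩; exact ⟨by linarith [hu.1], by linarith [hu.2]⟩
    · intro ht; exact ⟨(t + 1) / 2, ⟨by linarith [ht.1], by linarith [ht.2]⟩, by ring⟩
  have hderiv : ∀ u ∈ Ioo (0 : ℝ) 1, HasDerivWithinAt (fun u : ℝ => 2 * u - 1) 2 (Ioo 0 1) u := by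
    intro u _
    simpa using (((hasDerivAt_id u).const_mul 2).sub_const 1).hasDerivWithinAt
  have hinj : InjOn (fun u : ℝ => 2 * u - 1) (Ioo 0 1) := fun u _ v _ h => by
    simp only at h; linarith
  have hsub := lintegral_image_eq_lintegral_abs_deriv_mul measurableSet_Ioo hderiv hinj G
  rw [himg] at hsub
  rw [lintegral_unitLaw, hsub, ← lintegral_const_mul' _ _ ENNReal.ofReal_ne_top]
  refine lintegral_congr fun u => ?_
  rw [← mul_assoc, ← ENNReal.ofReal_mul (by norm_num), abs_of_pos two_pos]
  norm_num

/-- **`(2U₁−1, 2U₂−1)` is `¼ ×` Lebesgue measure on the square `(−1,1)²`.** -/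
theorem map_polarPt_unitLaw :
    (unitLaw.prod unitLaw).map polarPt =
      ENNReal.ofReal (1 / 4) • (volume : Measure (ℝ × ℝ)).restrict (Ioo (-1 : ℝ) 1 ×ˢ Ioo (-1 : ℝ) 1) := by
  refine Measure.ext_of_lintegral _ fun F hF => ?_
  rw [lintegral_map hF measurable_polarPt,
    lintegral_prod (fun q : ℝ × ℝ => F (polarPt q)) (hF.comp measurable_polarPt).aemeasurable]
  simp only [polarPt]
  have hinner : ∀ u : ℝ, ∫⁻ v, F (2 * u - 1, 2 * v - 1) ∂unitLaw =
      ENNReal.ofReal (1 / 2) * ∫⁻ t in Ioo (-1) 1, F (2 * u - 1, t) :=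
    fun u => lintegral_two_mul_sub_one_unitLaw (fun t => F (2 * u - 1, t))
  simp_rw [hinner]
  rw [lintegral_two_mul_sub_one_unitLaw (fun s => ENNReal.ofReal (1 / 2) * ∫⁻ t in Ioo (-1) 1, F (s, t)),
    lintegral_const_mul' _ _ ENNReal.ofReal_ne_top, ← mul_assoc, ← ENNReal.ofReal_mul (by norm_num),
    show (1 / 2 : ℝ) * (1 / 2) = 1 / 4 by norm_num, lintegral_smul_measure, smul_eq_mul,
    Measure.volume_eq_prod, ← Measure.prod_restrict, lintegral_prod _ hF.aemeasurable]

/-! ## §3 The rejection loop outputs the uniform law on the disc -/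

/-- The disc has positive area … -/
theorem volume_polarDisc_ne_zero : (volume : Measure (ℝ × ℝ)) polarDisc ≠ 0 := by
  have hsub : Ioo (1 / 4 : ℝ) (1 / 2) ×ˢ Ioo (1 / 4 : ℝ) (1 / 2) ⊆ polarDisc := by
    rintro ⟨u, v⟩ ⟨hu, hv⟩
    simp only [mem_setOf_eq, sq2]
    constructor <;> nlinarith [hu.1, hu.2, hv.1, hv.2]
  intro h
  have h0 := measure_mono_null hsub h
  rw [Measure.volume_eq_prod, Measure.prod_prod, Real.volume_Ioo, mul_eq_zero] at h0
  norm_num at h0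

/-- … and finite area. -/
theorem volume_polarDisc_ne_top : (volume : Measure (ℝ × ℝ)) polarDisc ≠ ∞ := by
  refine ne_top_of_le_ne_top ?_ (measure_mono polarDisc_subset_square)
  rw [Measure.volume_eq_prod, Measure.prod_prod, Real.volume_Ioo]
  exact ENNReal.mul_ne_top ENNReal.ofReal_ne_top ENNReal.ofReal_ne_top

/-- The accepted part of one round: `P(point ∈ A, accept) = ¼ vol(A ∩ D)`. -/
theorem polarRound_apply_prod_true {A : Set (ℝ × ℝ)} (hA : MeasurableSet A) :
    polarRound (A ×ˢ {true}) = ENNReal.ofReal (1 / 4) * volume (A ∩ polarDisc) := by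
  have hpre : (fun q : ℝ × ℝ => (polarPt q, decide (polarPt q ∈ polarDisc))) ⁻¹' (A ×ˢ {true}) =
      polarPt ⁻¹' (A ∩ polarDisc) := by
    ext q; simp
  rw [polarRound, Measure.map_apply measurable_polarRoundMap (hA.prod (measurableSet_singleton _)), hpre,
    ← Measure.map_apply measurable_polarPt (hA.inter measurableSet_polarDisc), map_polarPt_unitLaw,
    Measure.smul_apply, smul_eq_mul, Measure.restrict_apply (hA.inter measurableSet_polarDisc),
    inter_eq_left.2 (inter_subset_right.trans polarDisc_subset_square)]

/-- **THE REJECTION LOOP OUTPUTS THE UNIFORM LAW ON THE PUNCTURED UNIT DISC.** -/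
theorem loopLaw_polarRound :
    loopLaw polarRound = ((volume : Measure (ℝ × ℝ)) polarDisc)⁻¹ • (volume : Measure (ℝ × ℝ)).restrict polarDisc := by
  have h4 : ENNReal.ofReal (1 / 4 : ℝ) ≠ 0 := by rw [Ne, ENNReal.ofReal_eq_zero, not_le]; norm_num
  have hacc : accPart polarRound = ENNReal.ofReal (1 / 4) • (volume : Measure (ℝ × ℝ)).restrict polarDisc := by
    ext A hA
    rw [accPart_apply hA, polarRound_apply_prod_true hA, Measure.smul_apply, smul_eq_mul,
      Measure.restrict_apply hA]
  rw [loopLaw_eq, hacc, polarRound_apply_prod_true MeasurableSet.univ, univ_inter, smul_smul,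
    ENNReal.mul_inv (Or.inl h4) (Or.inl ENNReal.ofReal_ne_top), mul_assoc,
    mul_comm ((volume : Measure (ℝ × ℝ)) polarDisc)⁻¹, ← mul_assoc,
    ENNReal.inv_mul_cancel h4 ENNReal.ofReal_ne_top, one_mul]

/-- The loop halts almost surely (acceptance probability `π/4 > 0` per round). -/
instance isProbabilityMeasure_loopLaw_polarRound : IsProbabilityMeasure (loopLaw polarRound) := by
  refine isProbabilityMeasure_loopLaw ?_
  rw [polarRound_apply_prod_true MeasurableSet.univ, univ_inter]
  exact mul_ne_zero (by rw [Ne, ENNReal.ofReal_eq_zero, not_le]; norm_num) volume_polarDisc_ne_zero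

/-! ## §4 The output pair is `N(0,1) ⊗ N(0,1)` -/

/-- **The output map** `(u, v) ↦ (u f, v f)`, `f = √(−2 log s / s)`, `s = u² + v²`. -/
noncomputable def polarOut (p : ℝ × ℝ) : ℝ × ℝ :=
  (p.1 * Real.sqrt (-2 * Real.log (sq2 p) / sq2 p), p.2 * Real.sqrt (-2 * Real.log (sq2 p) / sq2 p))

/-- `polarOut` is measurable. -/
theorem measurable_polarOut : Measurable polarOut := by
  have hf : Measurable fun p : ℝ × ℝ => Real.sqrt (-2 * Real.log (sq2 p) / sq2 p) :=
    Real.continuous_sqrt.measurable.comp ((measurable_const.mul (Real.measurable_log.comp measurable_sq2)).div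
      measurable_sq2)
  exact (measurable_fst.mul hf).prodMk (measurable_snd.mul hf)

/-- In polar coordinates on the disc the output is `(ρ cos θ, ρ sin θ)` with `ρ = √(−2 log r²)`. -/
theorem polarOut_polar {r : ℝ} (hr : 0 < r) (θ : ℝ) :
    polarOut (r * Real.cos θ, r * Real.sin θ) =
      (Real.sqrt (-2 * Real.log (r ^ 2)) * Real.cos θ, Real.sqrt (-2 * Real.log (r ^ 2)) * Real.sin θ) := by
  have hs : sq2 (r * Real.cos θ, r * Real.sin θ) = r ^ 2 := by
    simp only [sq2]
    rw [show (r * Real.cos θ) ^ 2 + (r * Real.sin θ) ^ 2 = r ^ 2 * (Real.cos θ ^ 2 + Real.sin θ ^ 2) by ring,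
      cos_sq_add_sin_sq, mul_one]
  have hf : r * Real.sqrt (-2 * Real.log (r ^ 2) / r ^ 2) = Real.sqrt (-2 * Real.log (r ^ 2)) := by
    rw [Real.sqrt_div' _ (sq_nonneg r), Real.sqrt_sq hr.le, mul_div_cancel₀ _ hr.ne']
  simp only [polarOut, hs]
  refine Prod.ext ?_ ?_ <;> simp only <;> rw [mul_right_comm, hf]

/-- **Polar-coordinate evaluation**: for measurable `H ≥ 0`,
`∫_D H(polarOut p) dp = π · ∫ H d(N(0,1) ⊗ N(0,1))`. -/
theorem setLIntegral_polarDisc_polarOut {H : ℝ × ℝ → ℝ≥0∞} (hH : Measurable H) :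
    ∫⁻ p in polarDisc, H (polarOut p) = ENNReal.ofReal π * ∫⁻ z, H z ∂((gaussianReal 0 1).prod (gaussianReal 0 1)) := by
  have hHo : Measurable fun p => H (polarOut p) := hH.comp measurable_polarOut
  -- polar coordinates
  rw [← lintegral_indicator measurableSet_polarDisc, ← lintegral_comp_polarCoord_symm,
    show polarCoord.target = Ioi (0 : ℝ) ×ˢ Ioo (-π) π from rfl, Measure.volume_eq_prod,
    setLIntegral_prod _ (Measurable.aemeasurable ?_)]
  swap
  · exact (ENNReal.measurable_ofReal.comp measurable_fst).smul
      ((hHo.indicator measurableSet_polarDisc).comp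
        (by fun_prop : Measurable fun p : ℝ × ℝ => (p.1 * Real.cos p.2, p.1 * Real.sin p.2)))
  -- on the ray at angle θ: the indicator is `r < 1`, the output is `(ρ cos θ, ρ sin θ)`
  have hray : ∀ r ∈ Ioi (0 : ℝ), ∫⁻ θ in Ioo (-π) π,
      ENNReal.ofReal (r, θ).1 • (polarDisc.indicator fun p => H (polarOut p)) (polarCoord.symm (r, θ)) =
      (Ioo (0 : ℝ) 1).indicator (fun r => ENNReal.ofReal r * ∫⁻ θ in Ioo (-π) π,
        H (Real.sqrt (-2 * Real.log (r ^ 2)) * Real.cos θ, Real.sqrt (-2 * Real.log (r ^ 2)) * Real.sin θ)) r := by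
    intro r hr
    have hr' : (0 : ℝ) < r := hr
    have hs : ∀ θ : ℝ, sq2 (r * Real.cos θ, r * Real.sin θ) = r ^ 2 := fun θ => by
      simp only [sq2]
      rw [show (r * Real.cos θ) ^ 2 + (r * Real.sin θ) ^ 2 = r ^ 2 * (Real.cos θ ^ 2 + Real.sin θ ^ 2) by ring,
        cos_sq_add_sin_sq, mul_one]
    by_cases h1 : r < 1
    · rw [indicator_of_mem (show r ∈ Ioo (0 : ℝ) 1 from ⟨hr', h1⟩),
        ← lintegral_const_mul' _ _ ENNReal.ofReal_ne_top]
      refine setLIntegral_congr_fun measurableSet_Ioo fun θ _ => ?_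
      have hmem : (r * Real.cos θ, r * Real.sin θ) ∈ polarDisc := by
        refine ⟨by rw [hs]; positivity, by rw [hs]; nlinarith⟩
      rw [polarCoord_symm_apply, smul_eq_mul, indicator_of_mem hmem, polarOut_polar hr']
    · rw [indicator_of_notMem (show r ∉ Ioo (0 : ℝ) 1 from fun h => h1 h.2)]
      refine (setLIntegral_congr_fun measurableSet_Ioo fun θ _ => ?_).trans lintegral_zero
      have hnot : (r * Real.cos θ, r * Real.sin θ) ∉ polarDisc := fun h => h1 (by
        have := h.2; rw [hs] at this; nlinarith)
      rw [polarCoord_symm_apply, smul_eq_mul, indicator_of_notMem hnot, mul_zero]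
  rw [setLIntegral_congr_fun measurableSet_Ioi hray, ← lintegral_indicator measurableSet_Ioi,
    Set.indicator_indicator, show Ioi (0 : ℝ) ∩ Ioo 0 1 = Ioo 0 1 from
      inter_eq_right.2 Ioo_subset_Ioi_self, lintegral_indicator measurableSet_Ioo]
  -- substitute `s = r²` on `(0,1)`, then the Rayleigh substitution of `BoxMuller.lean`
  set K : ℝ → ℝ≥0∞ := fun ρ => ∫⁻ θ in Ioo (-π) π, H (ρ * Real.cos θ, ρ * Real.sin θ) with hK
  have himg : (fun r : ℝ => r ^ 2) '' Ioo 0 1 = Ioo 0 1 := by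
    ext s
    constructor
    · rintro ⟨r, hr, rfl⟩; exact ⟨pow_pos hr.1 2, by nlinarith [hr.1, hr.2]⟩
    · intro hs
      refine ⟨Real.sqrt s, ⟨Real.sqrt_pos.2 hs.1, (Real.sqrt_lt' one_pos).2 (by simpa using hs.2)⟩, Real.sq_sqrt hs.1.le⟩
  have hderiv : ∀ r ∈ Ioo (0 : ℝ) 1, HasDerivWithinAt (fun r : ℝ => r ^ 2) (2 * r) (Ioo 0 1) r := by
    intro r _
    simpa using (hasDerivAt_pow 2 r).hasDerivWithinAt
  have hinj : InjOn (fun r : ℝ => r ^ 2) (Ioo 0 1) := fun r hr s hs h =>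
    (pow_left_inj₀ hr.1.le hs.1.le two_ne_zero).1 h
  have hsub := lintegral_image_eq_lintegral_abs_deriv_mul measurableSet_Ioo hderiv hinj
    (fun s => K (Real.sqrt (-2 * Real.log s)))
  rw [himg] at hsub
  have hstep : ∫⁻ r in Ioo 0 1, ENNReal.ofReal r * K (Real.sqrt (-2 * Real.log (r ^ 2))) =
      ENNReal.ofReal (1 / 2) * ∫⁻ s in Ioo 0 1, K (Real.sqrt (-2 * Real.log s)) := by
    rw [hsub, ← lintegral_const_mul' _ _ ENNReal.ofReal_ne_top]
    refine setLIntegral_congr_fun measurableSet_Ioo fun r hr => ?_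
    rw [← mul_assoc, ← ENNReal.ofReal_mul (by norm_num), abs_of_pos (by linarith [hr.1])]
    congr 2
    ring
  rw [hstep, ← lintegral_unitLaw, lintegral_sqrt_neg_two_log_unitLaw K, lintegral_gaussian2_polar hH,
    ← lintegral_const_mul' _ _ ENNReal.ofReal_ne_top, ← lintegral_const_mul' _ _ ENNReal.ofReal_ne_top]
  refine setLIntegral_congr_fun measurableSet_Ioi fun ρ _ => ?_
  rw [hK]
  simp only []
  rw [← mul_assoc, ← ENNReal.ofReal_mul (by norm_num), ← lintegral_const_mul' _ _ ENNReal.ofReal_ne_top,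
    ← lintegral_const_mul' _ _ ENNReal.ofReal_ne_top]
  refine setLIntegral_congr_fun measurableSet_Ioo fun θ _ => ?_
  rw [← mul_assoc (ENNReal.ofReal π), ← ENNReal.ofReal_mul pi_pos.le]
  congr 2
  field_simp

/-- **The area of the (punctured) unit disc is `π`.** -/
theorem volume_polarDisc : (volume : Measure (ℝ × ℝ)) polarDisc = ENNReal.ofReal π := by
  have h := setLIntegral_polarDisc_polarOut (H := fun _ => 1) measurable_const
  rw [setLIntegral_const, one_mul, lintegral_const, measure_univ, mul_one, mul_one] at h
  exact h

/-- **THE MARSAGLIA POLAR METHOD IS EXACT**: the output pair of the loop is `N(0,1) ⊗ N(0,1)` — the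
returned variate and the cached spare are independent standard Gaussians. -/
theorem map_polarOut_loopLaw_polarRound :
    (loopLaw polarRound).map polarOut = (gaussianReal 0 1).prod (gaussianReal 0 1) := by
  refine Measure.ext_of_lintegral _ fun H hH => ?_
  rw [lintegral_map hH measurable_polarOut, loopLaw_polarRound, lintegral_smul_measure, smul_eq_mul,
    setLIntegral_polarDisc_polarOut hH, volume_polarDisc, ← mul_assoc,
    ENNReal.inv_mul_cancel (by rw [Ne, ENNReal.ofReal_eq_zero, not_le]; exact pi_pos) ENNReal.ofReal_ne_top, one_mul]

/-- Each output variate of the polar method is standard normal. -/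
theorem map_polarOut_fst :
    (loopLaw polarRound).map (fun p => (polarOut p).1) = gaussianReal 0 1 := by
  rw [show (fun p => (polarOut p).1) = Prod.fst ∘ polarOut from rfl,
    ← Measure.map_map measurable_fst measurable_polarOut, map_polarOut_loopLaw_polarRound, Measure.map_fst_prod,
    measure_univ, one_smul]

end Summit.Ventures.LatticeQCDFlow.Exactness
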